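import Summits.Parity.GeneralizedHardyLittlewood.Theorems.PrimeLevelFamEdgeMomentsBeyondDiagonalDiagBoseInner
import HarnessLib

/-!
# Route `PrimeLevelFamEdge`, crux K_A `MomentsBeyondDiagonal` (stmt-Parity-20007), line «petersson_layers» v4, stub `stub_diag`:
# THE BOSE COEFFICIENTS DECAY LIKE `e^{−√y}` — pairs far beyond the diagonal are exponentially irrelevant (census R2)

The universal coefficients of the diagonal line series (`…DiagBoseOuter.bose_expand`),
`c_{ab}(y) = ∫_{u₁>0}(log u₁)^a ∫_{u₂>y/u₁} e^{−φ}(1−e^{−φ})^{−2}(log u₂)^b du₂ du₁` (`φ = u₁+u₂`), are evaluated at `y = K/q̂²` with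
`K = (m₁/c)(m₂/c)`; BEYOND the diagonal (`Δ' > 1`) `y` exceeds `1` for the pairs with `m₁m₂/c² > q̂²`. On the region `u₁u₂ > y` one has
`φ ≥ 2√y` (AM–GM), hence `e^{−φ} ≤ e^{−√y} e^{−φ/2}`:

* `two_sqrt_le_add_div`, `bose_kernel_le_exp_sqrt` — `e^{−φ}(1−e^{−φ})^{−2} ≤ (1−e^{−√y})^{−2} e^{−√y} · e^{−u₁/2} e^{−u₂/2}` on the region;
* `integrableOn_exp_neg_half_mul_abs_logPow` — `∫_0^∞ e^{−u/2}|log u|^k du < ∞`;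
* `abs_bose_coeff_le` — **`|c_{ab}(y)| ≤ (1−e^{−√y})^{−2} e^{−√y} · M′_a M′_b`**, `M′_k = ∫_0^∞ e^{−u/2}|log u|^k` (`y > 0`):
  the pairs with `K ≥ q̂² log² q̂ · t` contribute `≪ e^{−√t·log q̂}` — only the CORNER `q̂² < K ≲ q̂² log² q̂` and the bulk `K ≤ q̂²`
  matter for the main term (cf. K_B `CornerNegligibleXSq` at `(P,Q) = (X²,1)`).
Helper `--supports stmt-Parity-20007`; closes nothing; K_A, K_B and the Parity summit are NOT proved; nothing about Landau–Siegel zeros.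
-/

noncomputable section

open Real Set MeasureTheory Filter
open Literature.NumberTheory.LFunctions

namespace Summit.Parity.GeneralizedHardyLittlewood.Theorems.MomentsBeyondDiagonal.DiagLines

/-- AM–GM on the line region: `2√y ≤ u₁ + u₂` when `u₁ > 0`, `u₂ > y/u₁`, `y ≥ 0`. [folklore] -/
theorem two_sqrt_le_add {y u₁ u₂ : ℝ} (hy : 0 ≤ y) (hu₁ : 0 < u₁) (hu₂ : y / u₁ < u₂) : 2 * Real.sqrt y ≤ u₁ + u₂ := by
  have hyu : y ≤ u₁ * u₂ := by rw [div_lt_iff₀ hu₁] at hu₂; linarith [hu₂]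
  have hs := Real.sq_sqrt hy
  have hu₂0 : 0 < u₂ := lt_of_le_of_lt (div_nonneg hy hu₁.le) hu₂
  have hφ0 : 0 ≤ u₁ + u₂ := by linarith
  by_contra hlt
  push Not at hlt
  have h1 : (u₁ + u₂) ^ 2 < (2 * Real.sqrt y) ^ 2 := pow_lt_pow_left₀ hlt hφ0 two_ne_zero
  nlinarith [sq_nonneg (u₁ - u₂), hs]

/-- **The Bose kernel on the line region gains `e^{−√y}`:** for `y > 0`, `u₁ > 0`, `u₂ > y/u₁`,
`e^{−(u₁+u₂)}(1−e^{−(u₁+u₂)})^{−2} ≤ (1−e^{−√y})^{−2} e^{−√y} · (e^{−u₁/2} e^{−u₂/2})`. [folklore] -/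
theorem bose_kernel_le_exp_sqrt {y u₁ u₂ : ℝ} (hy : 0 < y) (hu₁ : 0 < u₁) (hu₂ : y / u₁ < u₂) :
    Real.exp (-(u₁ + u₂)) / (1 - Real.exp (-(u₁ + u₂))) ^ 2 ≤
      ((1 - Real.exp (-Real.sqrt y)) ^ 2)⁻¹ * Real.exp (-Real.sqrt y) * (Real.exp (-(u₁ / 2)) * Real.exp (-(u₂ / 2))) := by
  have h2 := two_sqrt_le_add hy.le hu₁ hu₂
  have hs0 : 0 < Real.sqrt y := Real.sqrt_pos.mpr hy
  have hsq : Real.sqrt y ≤ u₁ + u₂ := by linarith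
  have he1 : Real.exp (-(u₁ + u₂)) ≤ Real.exp (-Real.sqrt y) := Real.exp_le_exp.mpr (by linarith)
  have he2 : Real.exp (-Real.sqrt y) < 1 := Real.exp_lt_one_iff.mpr (by linarith)
  have hden : (1 - Real.exp (-Real.sqrt y)) ^ 2 ≤ (1 - Real.exp (-(u₁ + u₂))) ^ 2 :=
    pow_le_pow_left₀ (by linarith) (by linarith) 2
  have hd0 : 0 < (1 - Real.exp (-Real.sqrt y)) ^ 2 := pow_pos (by linarith) 2
  -- `e^{-φ} = e^{-φ/2} e^{-φ/2} ≤ e^{-√y} e^{-u₁/2} e^{-u₂/2}`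
  have hnum : Real.exp (-(u₁ + u₂)) ≤ Real.exp (-Real.sqrt y) * (Real.exp (-(u₁ / 2)) * Real.exp (-(u₂ / 2))) := by
    rw [← Real.exp_add, ← Real.exp_add]
    exact Real.exp_le_exp.mpr (by linarith)
  rw [div_eq_mul_inv]
  calc Real.exp (-(u₁ + u₂)) * ((1 - Real.exp (-(u₁ + u₂))) ^ 2)⁻¹
      ≤ (Real.exp (-Real.sqrt y) * (Real.exp (-(u₁ / 2)) * Real.exp (-(u₂ / 2)))) * ((1 - Real.exp (-Real.sqrt y)) ^ 2)⁻¹ :=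
        mul_le_mul hnum (inv_anti₀ hd0 hden) (inv_nonneg.mpr (sq_nonneg _)) (by positivity)
    _ = _ := by ring

/-- `u ↦ e^{−u/2}|log u|^k` is integrable on `(0, ∞)` (substitute `u = 2v` in `e^{−v}|log 2 + log v|^k`). [folklore] -/
theorem integrableOn_exp_neg_half_mul_abs_logPow (k : ℕ) :
    IntegrableOn (fun u : ℝ ↦ Real.exp (-(u / 2)) * |Real.log u| ^ k) (Ioi 0) := by
  have h := integrableOn_exp_neg_mul_abs_logPow (Real.log 2) k
  -- `v ↦ f (v / 2)` i.e. `f ((1/2) * v)`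
  have h2 := (integrableOn_Ioi_comp_mul_left_iff (fun v : ℝ ↦ Real.exp (-v) * |Real.log 2 + Real.log v| ^ k) 0
    (by norm_num : (0 : ℝ) < 1 / 2)).mpr (by simpa using h)
  refine h2.congr_fun (fun u hu ↦ ?_) measurableSet_Ioi
  have hu : 0 < u := hu
  simp only
  rw [show (1 / 2 : ℝ) * u = u / 2 by ring, Real.log_div hu.ne' two_ne_zero]
  ring_nf

/-- **Exponential decay of the Bose coefficients.** For `y > 0` and all `a, b`:
`|∫_{u₁>0}(log u₁)^a ∫_{u₂>y/u₁} e^{−φ}(1−e^{−φ})^{−2}(log u₂)^b| ≤ (1−e^{−√y})^{−2} e^{−√y} · M′_a · M′_b`,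
`M′_k = ∫_0^∞ e^{−u/2}|log u|^k du`. [cite: KowalskiMichelVanderKam2000, (22) p. 12 — derivation («decays faster than any negative power»)] -/
theorem abs_bose_coeff_le {y : ℝ} (hy : 0 < y) (a b : ℕ) :
    |∫ u₁ in Ioi (0 : ℝ), Real.log u₁ ^ a *
        ∫ u₂ in Ioi (y / u₁), Real.exp (-(u₁ + u₂)) / (1 - Real.exp (-(u₁ + u₂))) ^ 2 * Real.log u₂ ^ b| ≤
      ((1 - Real.exp (-Real.sqrt y)) ^ 2)⁻¹ * Real.exp (-Real.sqrt y) *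
        (∫ u in Ioi (0 : ℝ), Real.exp (-(u / 2)) * |Real.log u| ^ a) *
        (∫ u in Ioi (0 : ℝ), Real.exp (-(u / 2)) * |Real.log u| ^ b) := by
  set C : ℝ := ((1 - Real.exp (-Real.sqrt y)) ^ 2)⁻¹ * Real.exp (-Real.sqrt y) with hC
  have hC0 : 0 ≤ C := by rw [hC]; positivity
  set Ma : ℝ := ∫ u in Ioi (0 : ℝ), Real.exp (-(u / 2)) * |Real.log u| ^ a with hMa
  set Mb : ℝ := ∫ u in Ioi (0 : ℝ), Real.exp (-(u / 2)) * |Real.log u| ^ b with hMb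
  have hinta := integrableOn_exp_neg_half_mul_abs_logPow a
  have hintb := integrableOn_exp_neg_half_mul_abs_logPow b
  have hMb0 : 0 ≤ Mb := setIntegral_nonneg measurableSet_Ioi fun u _ ↦ by positivity
  -- inner bound, for `u₁ > 0`
  have hinner : ∀ u₁ ∈ Ioi (0 : ℝ),
      ‖Real.log u₁ ^ a * ∫ u₂ in Ioi (y / u₁), Real.exp (-(u₁ + u₂)) / (1 - Real.exp (-(u₁ + u₂))) ^ 2 * Real.log u₂ ^ b‖ ≤
        C * Mb * (Real.exp (-(u₁ / 2)) * |Real.log u₁| ^ a) := by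
    intro u₁ hu₁
    have hu₁ : 0 < u₁ := hu₁
    have hz : 0 < y / u₁ := div_pos hy hu₁
    have hintbz : IntegrableOn (fun u : ℝ ↦ Real.exp (-(u / 2)) * |Real.log u| ^ b) (Ioi (y / u₁)) :=
      hintb.mono_set (Ioi_subset_Ioi hz.le)
    have hI : ‖∫ u₂ in Ioi (y / u₁), Real.exp (-(u₁ + u₂)) / (1 - Real.exp (-(u₁ + u₂))) ^ 2 * Real.log u₂ ^ b‖ ≤
        C * Real.exp (-(u₁ / 2)) * Mb := by
      calc ‖∫ u₂ in Ioi (y / u₁), Real.exp (-(u₁ + u₂)) / (1 - Real.exp (-(u₁ + u₂))) ^ 2 * Real.log u₂ ^ b‖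
          ≤ ∫ u₂ in Ioi (y / u₁), (C * Real.exp (-(u₁ / 2))) * (Real.exp (-(u₂ / 2)) * |Real.log u₂| ^ b) := by
            refine norm_integral_le_of_norm_le (hintbz.const_mul _) ?_
            rw [ae_restrict_iff' measurableSet_Ioi]
            refine ae_of_all _ fun u₂ (hu₂ : y / u₁ < u₂) ↦ ?_
            have hB := bose_kernel_le_exp_sqrt hy hu₁ hu₂
            have hB0 : 0 ≤ Real.exp (-(u₁ + u₂)) / (1 - Real.exp (-(u₁ + u₂))) ^ 2 :=
              div_nonneg (Real.exp_pos _).le (sq_nonneg _)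
            rw [norm_mul, Real.norm_of_nonneg hB0, norm_pow, Real.norm_eq_abs]
            calc Real.exp (-(u₁ + u₂)) / (1 - Real.exp (-(u₁ + u₂))) ^ 2 * |Real.log u₂| ^ b
                ≤ C * (Real.exp (-(u₁ / 2)) * Real.exp (-(u₂ / 2))) * |Real.log u₂| ^ b := by
                  rw [hC]; gcongr
              _ = _ := by ring
        _ = C * Real.exp (-(u₁ / 2)) * ∫ u₂ in Ioi (y / u₁), Real.exp (-(u₂ / 2)) * |Real.log u₂| ^ b :=
            integral_const_mul _ _
        _ ≤ C * Real.exp (-(u₁ / 2)) * Mb := by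
            refine mul_le_mul_of_nonneg_left ?_ (by positivity)
            exact setIntegral_mono_set hintb (ae_of_all _ fun u ↦ by positivity) (ae_of_all _ (Ioi_subset_Ioi hz.le))
    rw [norm_mul, norm_pow, Real.norm_eq_abs]
    calc |Real.log u₁| ^ a * ‖∫ u₂ in Ioi (y / u₁), Real.exp (-(u₁ + u₂)) / (1 - Real.exp (-(u₁ + u₂))) ^ 2 * Real.log u₂ ^ b‖
        ≤ |Real.log u₁| ^ a * (C * Real.exp (-(u₁ / 2)) * Mb) := mul_le_mul_of_nonneg_left hI (pow_nonneg (abs_nonneg _) _)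
      _ = C * Mb * (Real.exp (-(u₁ / 2)) * |Real.log u₁| ^ a) := by ring
  -- outer bound
  have hmaj : IntegrableOn (fun u₁ : ℝ ↦ C * Mb * (Real.exp (-(u₁ / 2)) * |Real.log u₁| ^ a)) (Ioi 0) := hinta.const_mul _
  have h := norm_integral_le_of_norm_le (μ := volume.restrict (Ioi (0 : ℝ))) hmaj
    (by rw [ae_restrict_iff' measurableSet_Ioi]; exact ae_of_all _ hinner)
  rw [Real.norm_eq_abs] at h
  refine h.trans (le_of_eq ?_)
  rw [integral_const_mul, hMa]
  ring

end Summit.Parity.GeneralizedHardyLittlewood.Theorems.MomentsBeyondDiagonal.DiagLines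

end
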